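import Summits.RiemannHypothesis.RiemannHypothesis.Theorems.MotivicDoorDeningerHodgeTwist
import Summits.RiemannHypothesis.RiemannHypothesis.Theorems.MotivicDoorDeningerPartner
import Literature.NumberTheory.LFunctions.ZetaZerosProofs

/-!
# The real-structure twist: with `∗` built from `ρ ↦ ρ̄` instead of `ρ ↦ 1 - ρ`, the `θ`-equivariance of `∗` is unconditional and the clause of (2.7) that carries RH is POSITIVITY (motivic door, cc-4 gen 3, part 4)

Parts 1–3 (`Theorems/MotivicDoorDeningerHodgeTwist.lean`, `…Partner.lean`, `…HodgePackage.lean`)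
realise Deninger's complete typed list (arXiv:2204.02714 §2) on a diagonal carrier with the Hodge
star `hodge σ s` built from the PARTNER involution `σ : ρ ↦ 1 - ρ`; there every clause holds
unconditionally except `∗θ = θ∗`, which is RH.  That location of the failure is an artefact of the
choice of `∗`.  This file builds the star from the OTHER involution of the zero multiset, complex
CONJUGATION `τ : ρ ↦ ρ̄` (`m(ρ̄) = m(ρ)`, `riemannZetaZeroOrder_conj`), keeping `C = cup σ s`
(which must pair weights `α` and `1 - α` by (2.5)/(2.6)):

* `∗_τ := hodge τ u` (same recipe as part 1, other involution): anti-linear, `∗_τ ∗_τ = -1`, and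
  `∗_τ θ = θ ∗_τ` UNCONDITIONALLY (`hodge_comm_iff` of part 1 with `conj (w (τ j)) = conj (conj ρ) = ρ`);
* `B_τ := C(·, ∗_τ ·) = mform σ s τ u`, `B_τ(f,g) = Σ_k f(k) conj (g(κ k))` with `κ := τ ∘ σ :
  ρ ↦ 1 - ρ̄` the REFLECTION IN THE CRITICAL LINE (`mform_apply`); Hermitian unconditionally
  (`mform_conj_symm`, `κ` an involution), and
* `PosDef B_τ ↔ κ = id` (`posDef_mform_iff`) — on the multiplicity index set: `↔ RiemannHypothesis`
  (`posDef_realForm_iff_riemannHypothesis`); hence `HodgeStar θ C ∗_τ B_τ ↔ RiemannHypothesis`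
  (`realHodgeStar_iff_riemannHypothesis`) with the failing clause now the scalar product.

Invariant statement for the cell's located-gap entry (HOME/LOCATED-GAP.md §cc-4, ruling G11)
[DERIVED from parts 1–4, each clause PROVED]: Deninger's list couples TWO involutions of `H¹` —
the duality partner (`C` pairs `H^{θ∼α}` with `H^{θ∼1-α}`) and the real structure behind the
anti-linear `∗` — and the bookkeeping carrier built from the zeros satisfies the complete list iff
the two involutions COINCIDE on the spectrum, i.e. iff the reflection `ρ ↦ 1 - ρ̄` fixes every zero,
i.e. iff RH.  Choosing `∗` from `σ` puts RH into `∗θ = θ∗`; choosing it from `τ` puts RH into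
`B > 0`; no bookkeeping choice satisfies both.  The located object is therefore a GEOMETRIC origin of
`∗` (Deninger: a leafwise metric with conformal flow, arXiv:math/0204110 §2; "we are missing a
fundamental 'twist' excluding real structures on cohomology", arXiv:2204.02714 Thm 2.13 ff.) that
delivers equivariance AND positivity at once.

Honest grade: reformulation; linear algebra and bookkeeping on the zero multiset (PROVED, kernel);
nothing constructs a geometric carrier.  HONEST FRAMING: lottery ticket at the motivic door; RH
probability negligible; consolation prizes are real: a new semi-local Weil-positivity theorem, or a
located gap in the Connes–Consani programme, plus the ff-door theorem.
References: C. Deninger, arXiv:2204.02714 §2; C. Deninger, arXiv:math/0204110 §2;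
E. C. Titchmarsh, The theory of the Riemann zeta-function (1986) §2.12.
-/

set_option linter.dupNamespace false

noncomputable section

open Complex Module Module.End
open Literature.NumberTheory.LFunctions Literature.NumberTheory.Deninger2022
open Summit.RiemannHypothesis.RiemannHypothesis.Theorems.MotivicDoor.DeningerHodgeTwist
open Summit.RiemannHypothesis.RiemannHypothesis.Theorems.MotivicDoor.DeningerPartner

namespace Summit.RiemannHypothesis.RiemannHypothesis.Theorems.MotivicDoor.DeningerRealTwist

variable {ι : Type}

/-! ## Generic: the mixed form `B(f,g) = C_σ(f, ∗_τ g)` for two involutions `σ`, `τ` -/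

/-- The would-be scalar product `B(h,h') := C(h, ∗h')` when the cup form is built from `σ` and the
Hodge star from `τ`. -/
def mform (σ : ι → ι) (s : ι → ℂ) (τ : ι → ι) (u : ι → ℂ) :
    (ι →₀ ℂ) →ₗ[ℂ] (ι →₀ ℂ) →ₗ⋆[ℂ] ℂ :=
  (cup σ s).compl₂ (hodge τ u)

/-- `B(h,h') = C(h,∗h')` by definition. -/
theorem mform_apply' (σ : ι → ι) (s : ι → ℂ) (τ : ι → ι) (u : ι → ℂ) (f g : ι →₀ ℂ) :
    mform σ s τ u f g = cup σ s f (hodge τ u g) := rfl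

/-- `B(f,g) = Σ_k f(k) conj (g(τ σ k))`: the standard form twisted by `κ = τ ∘ σ`. -/
theorem mform_apply {σ τ : ι → ι} (hτ : Function.Involutive τ) {s u : ι → ℂ}
    (hsu : ∀ k, s k * u (τ (σ k)) = 1) (f g : ι →₀ ℂ) :
    mform σ s τ u f g = ∑ k ∈ f.support, f k * starRingEnd ℂ (g (τ (σ k))) := by
  rw [mform_apply', cup_apply]
  refine Finset.sum_congr rfl (fun k _ => ?_)
  rw [hodge_apply hτ, ← mul_assoc (s k), hsu k, one_mul]

/-- The same sum over any finite set containing the support of the first argument. -/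
theorem mform_eq_sum {σ τ : ι → ι} (hτ : Function.Involutive τ) {s u : ι → ℂ}
    (hsu : ∀ k, s k * u (τ (σ k)) = 1) {f : ι →₀ ℂ} (g : ι →₀ ℂ) {S : Finset ι}
    (hS : f.support ⊆ S) :
    mform σ s τ u f g = ∑ k ∈ S, f k * starRingEnd ℂ (g (τ (σ k))) := by
  rw [mform_apply hτ hsu]
  exact Finset.sum_subset hS (fun k _ hk => by rw [Finsupp.notMem_support_iff.mp hk, zero_mul])

/-- **`B` is Hermitian unconditionally** (as soon as `κ = τ ∘ σ` is an involution). -/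
theorem mform_conj_symm {σ τ : ι → ι} (hτ : Function.Involutive τ) {s u : ι → ℂ}
    (hsu : ∀ k, s k * u (τ (σ k)) = 1) (hκ : ∀ k, τ (σ (τ (σ k))) = k) (f g : ι →₀ ℂ) :
    mform σ s τ u g f = starRingEnd ℂ (mform σ s τ u f g) := by
  classical
  have hκi : Function.Injective (fun k => τ (σ k)) := fun a b h => by
    have h' := congrArg (fun k => τ (σ k)) h
    simpa only [hκ] using h'
  set T : Finset ι := f.support ∪ g.support with hT
  set S : Finset ι := T ∪ T.map ⟨fun k => τ (σ k), hκi⟩ with hS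
  have hκS : ∀ k ∈ S, τ (σ k) ∈ S := by
    intro k hk
    rcases Finset.mem_union.mp hk with h | h
    · exact Finset.mem_union_right _ (Finset.mem_map.mpr ⟨k, h, rfl⟩)
    · obtain ⟨a, ha, hak⟩ := Finset.mem_map.mp h
      have hk' : τ (σ k) = a := by rw [← hak]; exact hκ a
      rw [hk']
      exact Finset.mem_union_left _ ha
  have hfS : f.support ⊆ S := Finset.subset_union_left.trans Finset.subset_union_left
  have hgS : g.support ⊆ S := Finset.subset_union_right.trans Finset.subset_union_left
  rw [mform_eq_sum hτ hsu f hgS, mform_eq_sum hτ hsu g hfS, map_sum]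
  refine Finset.sum_nbij' (fun k => τ (σ k)) (fun k => τ (σ k)) hκS hκS (fun k _ => hκ k)
    (fun k _ => hκ k) (fun k _ => ?_)
  rw [map_mul, Complex.conj_conj, hκ k, mul_comm]

/-- If `κ = τ ∘ σ` moves some index, `B` is not positive definite: the basis vector there is
`B`-isotropic. -/
theorem not_posDef_mform {σ τ : ι → ι} (hτ : Function.Involutive τ) {s u : ι → ℂ}
    (hsu : ∀ k, s k * u (τ (σ k)) = 1) {k₀ : ι} (hk : τ (σ k₀) ≠ k₀) :
    ¬ PosDef (mform σ s τ u) := by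
  intro hP
  have h := hP (Finsupp.single k₀ 1) (by simp)
  rw [mform_eq_sum hτ hsu (Finsupp.single k₀ (1 : ℂ)) Finsupp.support_single_subset,
    Finset.sum_singleton, Finsupp.single_eq_same, Finsupp.single_eq_of_ne hk, map_zero, mul_zero,
    Complex.zero_re] at h
  exact lt_irrefl 0 h

/-- If `κ = τ ∘ σ = id`, the mixed form is the form of part 1 (the standard scalar product). -/
theorem mform_eq_form {σ τ : ι → ι} (hσ : Function.Involutive σ) (hτ : Function.Involutive τ)
    {s u : ι → ℂ} (hs : ∀ i, s i = 1 ∨ s i = -1) (hsu : ∀ k, s k * u (τ (σ k)) = 1)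
    (hκ : ∀ k, τ (σ k) = k) : mform σ s τ u = form σ s := by
  refine LinearMap.ext fun f => LinearMap.ext fun g => ?_
  rw [mform_apply hτ hsu, form_apply hσ hs]
  exact Finset.sum_congr rfl (fun k _ => by rw [hκ k])

/-- **`B` is positive definite iff the two involutions coincide** (`τ ∘ σ = id`). -/
theorem posDef_mform_iff {σ τ : ι → ι} (hσ : Function.Involutive σ) (hτ : Function.Involutive τ)
    {s u : ι → ℂ} (hs : ∀ i, s i = 1 ∨ s i = -1) (hsu : ∀ k, s k * u (τ (σ k)) = 1) :
    PosDef (mform σ s τ u) ↔ ∀ k, τ (σ k) = k := by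
  constructor
  · intro hP k
    by_contra hk
    exact not_posDef_mform hτ hsu hk hP
  · intro hκ
    rw [mform_eq_form hσ hτ hs hsu hκ]
    exact posDef_form hσ hs

/-- **(2.7) for `(θ, C_σ, ∗_τ, B)` holds iff the two involutions coincide**, for a diagonal `θ`
whose weights satisfy `conj (w (τ j)) = w j` (so that `∗_τ θ = θ ∗_τ` is automatic). -/
theorem mixedHodgeStar_iff {σ τ : ι → ι} (hσ : Function.Involutive σ) (hτ : Function.Involutive τ)
    {s u : ι → ℂ} (hs : ∀ i, s i = 1 ∨ s i = -1) (hu : ∀ i, u i = 1 ∨ u i = -1)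
    (huτ : ∀ i, u (τ i) = -u i) (hsu : ∀ k, s k * u (τ (σ k)) = 1)
    (hκ : ∀ k, τ (σ (τ (σ k))) = k) {w : ι → ℂ} {θ : End ℂ (ι →₀ ℂ)}
    (hθ : ∀ f i, θ f i = w i * f i) (hw : ∀ j, starRingEnd ℂ (w (τ j)) = w j) :
    HodgeStar θ (cup σ s) (hodge τ u) (mform σ s τ u) ↔ ∀ k, τ (σ k) = k := by
  have hu0 : ∀ i, u i ≠ 0 := fun i => by rcases hu i with h | h <;> simp [h]
  constructor
  · rintro ⟨-, -, -, -, hpos⟩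
    exact (posDef_mform_iff hσ hτ hs hsu).1 hpos
  · intro h
    exact ⟨hodge_hodge hτ hu huτ, (hodge_comm_iff hτ hu0 hθ).2 hw, fun f g => rfl,
      fun f g => mform_conj_symm hτ hsu hκ f g, (posDef_mform_iff hσ hτ hs hsu).2 h⟩

/-! ## The conjugation involution on the multiplicity index set -/

section Model

open ZetaZeros.riemannZetaNontrivialZeros

/-- **`m(ρ̄) = m(ρ)` for every `ρ`** (`riemannZetaZeroOrder_conj`; the non-trivial zeros are
stable under conjugation). -/
theorem zetaMultiplicity_conj (α : ℂ) : zetaMultiplicity (starRingEnd ℂ α) = zetaMultiplicity α := by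
  unfold zetaMultiplicity
  by_cases h : α ∈ ZetaZeros.riemannZetaNontrivialZeros
  · rw [if_pos h, if_pos (conj_mem h), riemannZetaZeroOrder_conj_holds α]
  · have h' : starRingEnd ℂ α ∉ ZetaZeros.riemannZetaNontrivialZeros := fun h1 => h (by
      simpa using conj_mem h1)
    rw [if_neg h, if_neg h']

/-- The **conjugation involution** of the multiplicity index set (the real structure of the
bookkeeping carrier): the `j`-th basis vector of weight `ρ` goes to the `j`-th of weight `ρ̄`. -/
def conjIdx (i : Σ α : ℂ, Fin (zetaMultiplicity α)) : Σ α : ℂ, Fin (zetaMultiplicity α) :=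
  ⟨starRingEnd ℂ i.1, Fin.cast (zetaMultiplicity_conj i.1).symm i.2⟩

/-- The conjugate index has the conjugate weight. -/
@[simp] theorem conjIdx_fst (i : Σ α : ℂ, Fin (zetaMultiplicity α)) :
    (conjIdx i).1 = starRingEnd ℂ i.1 := rfl

/-- Conjugation keeps the position inside the fibre. -/
@[simp] theorem conjIdx_snd_val (i : Σ α : ℂ, Fin (zetaMultiplicity α)) :
    ((conjIdx i).2 : ℕ) = (i.2 : ℕ) := rfl

/-- `conjIdx` is an involution. -/
theorem conjIdx_conjIdx (i : Σ α : ℂ, Fin (zetaMultiplicity α)) : conjIdx (conjIdx i) = i := by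
  obtain ⟨ρ, j⟩ := i
  refine Sigma.ext (by simp) ?_
  exact (Fin.heq_ext_iff (by simp)).2 rfl

/-- `conjIdx` is an involution (bundled form). -/
theorem conjIdx_involutive : Function.Involutive conjIdx := conjIdx_conjIdx

/-- The sign is odd under conjugation (non-trivial zeros are non-real). -/
theorem sgn_conjIdx (i : Σ α : ℂ, Fin (zetaMultiplicity α)) : sgn (conjIdx i) = -sgn i := by
  have hmem : i.1 ∈ ZetaZeros.riemannZetaNontrivialZeros := (zetaMultiplicity_pos_iff i.1).1 (Fin.pos i.2)
  have him : i.1.im ≠ 0 := im_ne_zero hmem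
  unfold sgn
  simp only [conjIdx_fst, Complex.conj_im, Left.neg_pos_iff]
  by_cases h : 0 < i.1.im
  · rw [if_pos h, if_neg (not_lt.mpr h.le)]
  · rw [if_neg h, if_pos (lt_of_le_of_ne (not_lt.mp h) him), neg_neg]

/-- The reflection `κ = conjIdx ∘ partner : ρ ↦ 1 - ρ̄` preserves the sign of `Im ρ`. -/
theorem sgn_conjIdx_partner (k : Σ α : ℂ, Fin (zetaMultiplicity α)) :
    sgn (conjIdx (partner k)) = sgn k := by
  rw [sgn_conjIdx, sgn_partner, neg_neg]

/-- The sign hypothesis `s k · u (κ k) = 1` of the generic part, on the index set. -/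
theorem sgn_mul_sgn_conjIdx_partner (k : Σ α : ℂ, Fin (zetaMultiplicity α)) :
    sgn k * sgn (conjIdx (partner k)) = 1 := by
  rw [sgn_conjIdx_partner]
  rcases sgn_cases k with h | h <;> simp [h]

/-- The reflection in the critical line, `κ = conjIdx ∘ partner`, is an involution of the index set. -/
theorem reflect_reflect (k : Σ α : ℂ, Fin (zetaMultiplicity α)) :
    conjIdx (partner (conjIdx (partner k))) = k := by
  obtain ⟨ρ, j⟩ := k
  refine Sigma.ext ?_ ?_
  · simp [map_sub, map_one]
  · exact (Fin.heq_ext_iff (by simp [map_sub, map_one])).2 rfl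

/-- **The two involutions coincide exactly under RH**: `ρ̄ = 1 - ρ` for every index, i.e. the
reflection in the critical line fixes every non-trivial zero. -/
theorem conjIdx_partner_eq_self_iff_riemannHypothesis :
    (∀ k : Σ α : ℂ, Fin (zetaMultiplicity α), conjIdx (partner k) = k) ↔ RiemannHypothesis := by
  rw [← conj_partner_iff_riemannHypothesis]
  constructor
  · intro h k
    exact congrArg Sigma.fst (h k)
  · intro h k
    obtain ⟨ρ, j⟩ := k
    have h1 : starRingEnd ℂ (1 - ρ) = ρ := h ⟨ρ, j⟩
    have h2 : zetaMultiplicity (starRingEnd ℂ (1 - ρ)) = zetaMultiplicity ρ :=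
      congrArg zetaMultiplicity h1
    exact Sigma.ext h1 ((Fin.heq_ext_iff h2).2 rfl)

/-! ## The real-structure package on the index set -/

/-- **`∗_τ θ = θ ∗_τ` holds UNCONDITIONALLY** for the conjugation star and any operator diagonal with
the weights `(ρ, j) ↦ ρ`. -/
theorem realStar_comm {θ : End ℂ ((Σ α : ℂ, Fin (zetaMultiplicity α)) →₀ ℂ)}
    (hθ : ∀ f i, θ f i = i.1 * f i) (g : (Σ α : ℂ, Fin (zetaMultiplicity α)) →₀ ℂ) :
    hodge conjIdx sgn (θ g) = θ (hodge conjIdx sgn g) :=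
  (hodge_comm_iff conjIdx_involutive (fun i => by rcases sgn_cases i with h | h <;> simp [h]) hθ).2
    (fun j => by simp) g

/-- `∗_τ ∗_τ = -1` unconditionally. -/
theorem realStar_realStar (g : (Σ α : ℂ, Fin (zetaMultiplicity α)) →₀ ℂ) :
    hodge conjIdx sgn (hodge conjIdx sgn g) = -g :=
  hodge_hodge conjIdx_involutive sgn_cases sgn_conjIdx g

/-- `B_τ` is Hermitian unconditionally. -/
theorem realForm_conj_symm (f g : (Σ α : ℂ, Fin (zetaMultiplicity α)) →₀ ℂ) :
    mform partner sgn conjIdx sgn g f = starRingEnd ℂ (mform partner sgn conjIdx sgn f g) :=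
  mform_conj_symm conjIdx_involutive sgn_mul_sgn_conjIdx_partner reflect_reflect f g

/-- **`B_τ = C(·, ∗_τ ·)` is positive definite iff RH.** -/
theorem posDef_realForm_iff_riemannHypothesis :
    PosDef (mform partner sgn conjIdx sgn) ↔ RiemannHypothesis :=
  (posDef_mform_iff partner_involutive conjIdx_involutive sgn_cases
    sgn_mul_sgn_conjIdx_partner).trans conjIdx_partner_eq_self_iff_riemannHypothesis

/-- **(2.7) for the real-structure star is the Riemann Hypothesis, the failing clause being
positivity** (compare part 1/3: for the partner star the failing clause is `∗θ = θ∗`). -/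
theorem realHodgeStar_iff_riemannHypothesis {θ : End ℂ ((Σ α : ℂ, Fin (zetaMultiplicity α)) →₀ ℂ)}
    (hθ : ∀ f i, θ f i = i.1 * f i) :
    HodgeStar θ (cup partner sgn) (hodge conjIdx sgn) (mform partner sgn conjIdx sgn) ↔
      RiemannHypothesis :=
  (mixedHodgeStar_iff partner_involutive conjIdx_involutive sgn_cases sgn_cases sgn_conjIdx
    sgn_mul_sgn_conjIdx_partner reflect_reflect hθ (fun j => by simp)).trans
    conjIdx_partner_eq_self_iff_riemannHypothesis

end Model

end Summit.RiemannHypothesis.RiemannHypothesis.Theorems.MotivicDoor.DeningerRealTwist
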